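import Mathlib
import Summits.AtomisticToContinuum.Crystallization.Theorems.HolmgrenBoyleLindHullBalance
import Summits.AtomisticToContinuum.Crystallization.Theorems.HolmgrenBoyleLindHalfSpaceUniqueContinuationBarlowStackingUC
import Summits.AtomisticToContinuum.Crystallization.Theorems.HolmgrenBoyleLindHalfSpaceUniqueContinuationHaggAsymptoticPair

/-!
# Route `HolmgrenBoyleLind`, crux `HalfSpaceUniqueContinuation`: every Barlow stacking in exact
Lennard-Jones force balance is periodic
Support file for the crux item stmt-AtomisticToContinuum-6075 (`HalfSpaceUniqueContinuation` ⟺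
«every FLC Delone Lennard-Jones equilibrium of `ℝ³` is periodic»), line `registered`, lead c1:
the BARLOW CLASS of the crux, closed. For the equal-spacing Barlow stackings
`barlowStacking a h s` of the tree (triangular layers of spacing `a` in the planes `x₃ = k h`,
letters `A/B/C` coded by a Hägg sequence `s`):

* `hbl_barlowStacking_mem_hull` — the stacking of any sequence `x` in the orbit closure of `s`
  (every centred window of `x` occurs in `s`) lies in the patch-hull of the stacking of `s`
  (translate by `m h e₃ + L_s(m) w`; labels add along occurring windows,
  `hbl_haggLabel_add_of_window`), hence inherits exact force balance (`hbl_hull_balanced`);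
* `hbl_barlowStacking_periodic_of_balanced` — **if `barlowStacking a h s` (`a, h > 0`, `s` a Hägg
  sequence) is in exact Lennard-Jones force balance, then `s` is periodic** (so the stacking is a
  periodic crystal, `barlowPeriodicConfiguration`). Proof: otherwise `s` has an asymptotic pair
  `x, y` in its orbit closure (`hbl_hagg_exists_asymptotic_pair`); their stackings are balanced
  hull elements agreeing below the plane `x₃ = h/2` (equal pasts ⇒ equal letters for `k ≤ 0`)
  hence EQUAL (`hbl_barlowStacking_eq_of_agree_below`: a thick letter below, transverse Blaschke
  on the defect column), while layer `1` carries the letters `x 0 ≠ y 0` — absurd.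

Valid for all `a, h > 0` — no dominance condition on `h/a`, no numerics: ideal aperiodic
close-packed polytypes (and every non-periodic Hägg coding) are never in Lennard-Jones
mechanical equilibrium, as the route's thesis predicts (`FLCEquilibriumPeriodic`).
All `[folklore]`; nothing here closes an item.
-/

noncomputable section

namespace Summit.AtomisticToContinuum.Crystallization.Theorems.HolmgrenBoyleLind

open scoped BigOperators Topology InnerProductSpace
open Finset
open Literature.MathematicalPhysics.StatisticalMechanics
open Summit.AtomisticToContinuum.Crystallization.Theorems

local notation "𝔼" => EuclideanSpace ℝ (Fin 3)

/-! ## Labels of a sequence occurring in another -/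

/-- If the centred `N`-window of `x` occurs in `s` at `m`, the labels satisfy
`L_s (m + k) = L_s m + L_x k` for `|k| ≤ N`. [folklore] -/
theorem hbl_haggLabel_add_of_window {s x : ℤ → ℤ} {m : ℤ} {N : ℕ}
    (hw : ∀ k : ℤ, |k| ≤ N → x k = s (m + k)) {k : ℤ} (hk : |k| ≤ N) :
    haggLabel s (m + k) = haggLabel s m + haggLabel x k := by
  rcases le_or_gt 0 k with hk0 | hk0
  · lift k to ℕ using hk0
    rw [haggLabel_add_natCast, haggLabel_natCast]
    congr 1
    simp only [haggWindow]
    refine sum_congr rfl fun i hi => ?_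
    rw [zero_add, hw i ?_]
    rw [mem_range] at hi
    rw [abs_of_nonneg (by positivity)]
    have : |(k : ℤ)| = k := abs_of_nonneg (by positivity)
    rw [this] at hk
    exact_mod_cast (le_of_lt hi).trans (by exact_mod_cast hk)
  · obtain ⟨n, rfl⟩ : ∃ n : ℕ, k = -(n : ℤ) := ⟨(-k).toNat, by omega⟩
    rw [haggLabel_neg_natCast]
    have h1 := haggLabel_add_natCast s (m + -(n : ℤ)) n
    rw [show m + -(n : ℤ) + n = m by ring] at h1
    have h2 : haggWindow s (m + -(n : ℤ)) n = haggWindow x (-(n : ℤ)) n := by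
      simp only [haggWindow]
      refine sum_congr rfl fun i hi => ?_
      rw [mem_range] at hi
      rw [hw (-(n : ℤ) + i) ?_, add_assoc]
      rw [abs_le]
      rw [abs_neg, Nat.abs_cast] at hk
      constructor <;> omega
    rw [h1, h2]
    ring

/-! ## Orbit-closure stackings are patch-hull elements -/

/-- **Stackings coded by sequences in the orbit closure of `s` lie in the patch-hull of the
stacking of `s`.** If every centred window of `x` occurs in `s`, then every closed central ball of
`barlowStacking a h x` is an exact translate of a patch of `barlowStacking a h s` (translate by
`m h e₃ + L_s(m) w`, where the window of radius `⌈R/h⌉₊` occurs at `m`). [folklore] -/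
theorem hbl_barlowStacking_mem_hull {a h : ℝ} (hh : 0 < h) {s x : ℤ → ℤ}
    (hx : ∀ N : ℕ, ∃ m : ℤ, ∀ k : ℤ, |k| ≤ N → x k = s (m + k)) :
    ∀ R : ℝ, ∃ v : 𝔼, {z : 𝔼 | z ∈ barlowStacking a h x ∧ ‖z‖ ≤ R} =
      {z : 𝔼 | z + v ∈ barlowStacking a h s ∧ ‖z‖ ≤ R} := by
  intro R
  set N : ℕ := ⌈R / h⌉₊ with hN
  obtain ⟨m, hm⟩ := hx N
  set v : 𝔼 := (m : ℝ) • layerNormal h + (haggLabel s m : ℝ) • barlowOffset a with hv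
  -- the translation identity on the window
  have hshift : ∀ k : ℤ, |k| ≤ N → ∀ i j : ℤ,
      barlowPos a h x k i j + v = barlowPos a h s (m + k) i j := by
    intro k hk i j
    have hL : (haggLabel s (m + k) : ℝ) = haggLabel s m + haggLabel x k := by
      exact_mod_cast hbl_haggLabel_add_of_window hm hk
    ext l
    fin_cases l <;>
      simp [hv, barlowPos, triangularVec₁, triangularVec₂, barlowOffset, layerNormal, hL] <;> ring
  -- layers met by the ball
  have hlayer : ∀ (t : ℤ → ℤ) (k i j : ℤ), ‖barlowPos a h t k i j‖ ≤ R → |k| ≤ N := by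
    intro t k i j hz
    have h1 : |(k : ℝ) * h| ≤ R := by
      have : |(barlowPos a h t k i j) 2| ≤ ‖barlowPos a h t k i j‖ := by
        simpa only [Real.norm_eq_abs] using PiLp.norm_apply_le (barlowPos a h t k i j) 2
      rw [barlowPos_apply_two] at this
      exact this.trans hz
    rw [abs_mul, abs_of_pos hh] at h1
    have h2 : |(k : ℝ)| ≤ R / h := by rwa [le_div_iff₀ hh]
    have h3 : |(k : ℝ)| ≤ N := h2.trans (Nat.le_ceil _)
    rw [← Int.cast_abs] at h3
    exact_mod_cast h3
  refine ⟨v, Set.ext fun z => ?_⟩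
  simp only [Set.mem_setOf_eq]
  constructor
  · rintro ⟨⟨k, i, j, rfl⟩, hzR⟩
    refine ⟨?_, hzR⟩
    rw [hshift k (hlayer x k i j hzR) i j]
    exact barlowPos_mem _ _ _
  · rintro ⟨⟨k', i, j, hk'⟩, hzR⟩
    refine ⟨⟨k' - m, i, j, ?_⟩, hzR⟩
    have hz : z = barlowPos a h s k' i j - v := by rw [← hk', add_sub_cancel_right]
    -- the layer index `k' - m` is within the window
    have hk : |k' - m| ≤ N := by
      have h0 : |z 2| ≤ ‖z‖ := by simpa only [Real.norm_eq_abs] using PiLp.norm_apply_le z 2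
      have h1 : |z 2| ≤ R := h0.trans hzR
      rw [hz] at h1
      have h2 : (barlowPos a h s k' i j - v) 2 = ((k' : ℝ) - m) * h := by
        simp [hv, layerNormal, barlowOffset, sub_mul]
      rw [h2, abs_mul, abs_of_pos hh] at h1
      have h3 : |(k' : ℝ) - m| ≤ R / h := by rwa [le_div_iff₀ hh]
      have h4 : |(k' : ℝ) - m| ≤ N := h3.trans (Nat.le_ceil _)
      rw [← Int.cast_sub, ← Int.cast_abs] at h4
      exact_mod_cast h4
    have h5 := hshift (k' - m) hk i j
    rw [show m + (k' - m) = k' by ring] at h5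
    rw [hz, ← h5, add_sub_cancel_right]

/-! ## Balanced Barlow stackings are periodic -/

/-- Labels of two sequences with the same past agree at non-positive indices. [folklore] -/
theorem hbl_haggLabel_eq_of_past_eq {x y : ℤ → ℤ} (hxy : ∀ k : ℤ, k < 0 → x k = y k) {k : ℤ}
    (hk : k ≤ 0) : haggLabel x k = haggLabel y k := by
  obtain ⟨n, rfl⟩ : ∃ n : ℕ, k = -(n : ℤ) := ⟨(-k).toNat, by omega⟩
  rw [haggLabel_neg_natCast, haggLabel_neg_natCast]
  congr 1
  simp only [haggWindow]
  refine sum_congr rfl fun i hi => ?_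
  rw [mem_range] at hi
  exact hxy _ (by omega)

/-- **Every Barlow stacking in exact Lennard-Jones force balance is periodic.** For `a, h > 0`
and a Hägg sequence `s`, if every point of `barlowStacking a h s` is in exact Lennard-Jones force
balance (`HasSum` of the pair forces `= 0`), then `s` is periodic. Otherwise an asymptotic pair
`x, y` of the orbit closure of `s` (`hbl_hagg_exists_asymptotic_pair`) codes two balanced hull
elements (`hbl_barlowStacking_mem_hull`, `hbl_hull_balanced`) that agree below `x₃ = h/2` and are
therefore equal (`hbl_barlowStacking_eq_of_agree_below`), although their layers `1` carry the
different letters `x 0 ≠ y 0`. No condition on `h/a`. [folklore] -/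
theorem hbl_barlowStacking_periodic_of_balanced :
    ∀ (a h : ℝ), 0 < a → 0 < h → ∀ (s : ℤ → ℤ), IsHaggSeq s →
      (∀ x ∈ barlowStacking a h s,
        HasSum (fun y : {y : EuclideanSpace ℝ (Fin 3) // y ∈ barlowStacking a h s ∧ y ≠ x} =>
          (deriv lennardJones (dist x y) / dist x y) • (x - (y : EuclideanSpace ℝ (Fin 3)))) 0) →
      ∃ p : ℕ, 0 < p ∧ ∀ k : ℤ, s (k + p) = s k := by
  intro a h ha hh s hs hbal
  by_contra hnp
  obtain ⟨x, y, hxH, hyH, hxcl, hycl, hpast, hne⟩ := hbl_hagg_exists_asymptotic_pair s hs hnp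
  -- the two stackings are balanced hull elements
  have hδ : 0 < min a h := lt_min ha hh
  have hsep : ∀ p ∈ barlowStacking a h s, ∀ q ∈ barlowStacking a h s, p ≠ q → min a h ≤ dist p q :=
    fun p hp q hq hpq => le_dist_of_mem_barlowStacking a h s ha.le hh.le hp hq hpq
  have hbalx := hbl_hull_balanced hδ hsep hbal (hbl_barlowStacking_mem_hull (a := a) hh hxcl)
  have hbaly := hbl_hull_balanced hδ hsep hbal (hbl_barlowStacking_mem_hull (a := a) hh hycl)
  -- they agree below the plane `x₃ = h/2`
  have hlab : ∀ k : ℤ, k ≤ 0 → haggLabel x k = haggLabel y k := fun k hk =>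
    hbl_haggLabel_eq_of_past_eq hpast hk
  have hlow : ∀ (t : ℤ → ℤ) (k i j : ℤ), (barlowPos a h t k i j) 2 < h / 2 → k ≤ 0 := by
    intro t k i j hz
    rw [barlowPos_apply_two] at hz
    by_contra hk
    push Not at hk
    have h1 : (1 : ℝ) ≤ k := by exact_mod_cast hk
    nlinarith
  have hagree : ∀ z : 𝔼, z 2 < h / 2 → (z ∈ barlowStacking a h x ↔ z ∈ barlowStacking a h y) := by
    intro z hz
    constructor
    · rintro ⟨k, i, j, rfl⟩
      exact (hbl_barlowPos_mem_iff ha.ne' hh.ne' k i j).2 (by rw [hlab k (hlow x k i j hz)])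
    · rintro ⟨k, i, j, rfl⟩
      exact (hbl_barlowPos_mem_iff ha.ne' hh.ne' k i j).2 (by rw [hlab k (hlow y k i j hz)])
  have heq := hbl_barlowStacking_eq_of_agree_below a h ha hh x y hxH hbalx hbaly (h / 2) hagree
  -- but layer `1` carries different letters
  have hmem : barlowPos a h x 1 0 0 ∈ barlowStacking a h y := by
    rw [← heq]
    exact barlowPos_mem 1 0 0
  have hmod := (hbl_barlowPos_mem_iff ha.ne' hh.ne' 1 0 0).1 hmem
  have hx1 : haggLabel x 1 = x 0 := by
    have := haggLabel_succ x 0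
    rw [zero_add, haggLabel_zero, zero_add] at this
    exact this
  have hy1 : haggLabel y 1 = y 0 := by
    have := haggLabel_succ y 0
    rw [zero_add, haggLabel_zero, zero_add] at this
    exact this
  rw [hx1, hy1, Int.ModEq] at hmod
  rcases hxH 0 with h1 | h1 <;> rcases hyH 0 with h2 | h2 <;> rw [h1, h2] at hmod hne <;> omega


/-- **Balanced Barlow stackings are periodic crystals** — the conclusion of the route item
`FLCEquilibriumPeriodic` for the Barlow class: a Barlow stacking `barlowStacking a h s`
(`a, h > 0`, `s` a Hägg sequence) in exact Lennard-Jones force balance is the point set of a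
periodic configuration (`barlowPeriodicConfiguration` of the period found by
`hbl_barlowStacking_periodic_of_balanced`). [folklore] -/
theorem hbl_barlowStacking_exists_periodicConfiguration_of_balanced {a h : ℝ} (ha : 0 < a)
    (hh : 0 < h) {s : ℤ → ℤ} (hs : IsHaggSeq s)
    (hbal : ∀ x ∈ barlowStacking a h s,
      HasSum (fun y : {y : 𝔼 // y ∈ barlowStacking a h s ∧ y ≠ x} =>
        (deriv lennardJones (dist x y) / dist x y) • (x - (y : 𝔼))) 0) :
    ∃ P : PeriodicConfiguration 3, P.points = barlowStacking a h s := by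
  obtain ⟨p, hp, hper⟩ := hbl_barlowStacking_periodic_of_balanced a h ha hh s hs hbal
  exact ⟨barlowPeriodicConfiguration s ha.ne' hh.ne' hp.ne' hper,
    barlowPeriodicConfiguration_points s ha.ne' hh.ne' hp.ne' hper⟩

end Summit.AtomisticToContinuum.Crystallization.Theorems.HolmgrenBoyleLind

end
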